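import Summits.AnomalousDissipation.AnomalousDissipation.Theorems.SolenoidalFractalHomogenisationRealisedQuasiStaticCellLawCellUnique
import Summits.AnomalousDissipation.AnomalousDissipation.Theorems.IsotropicCubatureWord
import Literature.Analysis.FunctionSpaces.TorusPeriodicLocalization
import HarnessLib

/-!
# K2R `RealisedQuasiStaticCellLaw`, line `floquet-bloch`: UPPER-side glue (one solution ⇒ every solution; regime monotonicity)
# (`--supports stmt-AnomalousDissipation-20446`, helper)

Summits-side file (everything proved; no definitions, no named facts). The UPPER half of the registered skeleton r20
of line `floquet-bloch` (sha16 5d75d3efc45ae287) minus its one open stub: the registered stub `stub_upperSome`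
(ONE weak `A = 0` solution from the single long-wave mode `Re(e_ℓ)p` keeping the fraction `ν/K` of
`exp(−8π²‖ℓ‖²(1 + (1+δ)c_W/ν²)(ν/n²)t)` of its energy) is taken here as the HYPOTHESIS `hU`, verbatim, and turned into
the second inner conjunct of the crux for EVERY weak solution by the landed weak uniqueness `stub_cellUnique` (p526330);
`upperModeLaw_mono` merges regimes (smaller `ν₀`, larger `K`). The by-name closer applies `upperLaw_of_upperSome` to the
T2 lane's `stub_upperSome` once it lands.
-/

set_option linter.dupNamespace false

noncomputable section

namespace Summit.AnomalousDissipation.AnomalousDissipation.Theorems.SolenoidalFractalHomogenisation.RealisedQuasiStaticCellLaw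

open Set MeasureTheory
open scoped InnerProductSpace
open Literature.Analysis Literature.Analysis.FunctionSpaces Literature.Analysis.FunctionSpaces.Torus
open Literature.Analysis.FluidPDE Literature.Analysis.FluidPDE.LatticeShear

/-- Non-zero integer lattice vectors have norm at least `1`, so `‖ℓ‖·⌈K/ν⌉ ≤ n` gives `⌈K/ν⌉ ≤ n`. -/
theorem ceil_le_of_norm_latticeVec_mul_ceil_le {K ν : ℝ} {n : ℕ} {ℓ : Fin 3 → ℤ} (hℓ : ℓ ≠ 0)
    (hn : ‖FunctionSpaces.Torus.latticeVec ℓ‖ * (⌈K / ν⌉₊ : ℝ) ≤ n) : (⌈K / ν⌉₊ : ℝ) ≤ n := by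
  have h1 : (1:ℝ) ≤ ‖FunctionSpaces.Torus.latticeVec ℓ‖ := one_le_norm_latticeVec hℓ
  nlinarith [Nat.cast_nonneg (α := ℝ) ⌈K / ν⌉₊]

/-- In the regime `‖ℓ‖·⌈K/ν⌉ ≤ n` with `ℓ ≠ 0`, `K, ν > 0` the cell viscosity `ν/n²` is positive. -/
theorem cellKappa_pos_of_mode {K ν : ℝ} (hK : 0 < K) (hν : 0 < ν) {n : ℕ} {ℓ : Fin 3 → ℤ} (hℓ : ℓ ≠ 0)
    (hn : ‖FunctionSpaces.Torus.latticeVec ℓ‖ * (⌈K / ν⌉₊ : ℝ) ≤ n) : 0 < ν / (n:ℝ) ^ 2 := by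
  have hc := ceil_le_of_norm_latticeVec_mul_ceil_le (K := K) (ν := ν) hℓ hn
  have h1 : (1:ℝ) ≤ ⌈K / ν⌉₊ := by exact_mod_cast Nat.one_le_iff_ne_zero.mpr (Nat.ceil_pos.mpr (div_pos hK hν)).ne'
  have hn' : (0:ℝ) < n := lt_of_lt_of_le (lt_of_lt_of_le one_pos h1) hc
  positivity

/-- **UPPER side for EVERY weak solution from ONE solution with the lower energy bound.** If (hypothesis `hU`, the
registered stub `stub_upperSome` of line `floquet-bloch` verbatim) every single long-wave mode `Re(e_ℓ)p`, `p ⊥ ℓ`,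
`‖ℓ‖⌈K/ν⌉ ≤ n`, admits SOME weak `A = 0` solution around the replayed stretched cubature cells keeping at least
`(ν/K)·exp(−8π²‖ℓ‖²(1 + (1+δ)c_W/ν²)(ν/n²)t)` of its energy, then EVERY weak solution from that datum does — two weak
solutions agree for a.e. `t` (`stub_cellUnique`), hence have the same energy for a.e. `t`. -/
theorem upperLaw_of_upperSome
    (hU : ∀ δ > (0:ℝ), ∃ M₀ > (0:ℝ), ∀ M : ℝ, ∀ hM : 0 < M, M₀ ≤ M → ∃ ν₀ > (0:ℝ), ∃ K > (0:ℝ),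
      ∀ ν, ∀ hν : ν ∈ Ioo 0 ν₀, ∀ n : ℕ, ∀ ℓ : Fin 3 → ℤ, ℓ ≠ 0 →
      ‖FunctionSpaces.Torus.latticeVec ℓ‖ * (⌈K / ν⌉₊ : ℝ) ≤ n → ∀ p : EuclideanSpace ℝ (Fin 3), ‖p‖ = 1 →
      ⟪p, FunctionSpaces.Torus.latticeVec ℓ⟫_ℝ = 0 → ∀ T > (0:ℝ),
      ∃ w, Torus.IsWeakPassiveVectorOn 0 T (ν / (n:ℝ) ^ 2)
          (((cubatureWord.stretch M hM).stretch (1 / ν) (one_div_pos.mpr hν.1)).cell n)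
          (fun x => (UnitAddTorus.mFourier ℓ x).re • p) w ∧
        ∀ᵐ t ∂(volume.restrict (Ioo 0 T)),
          (ν / K) * Real.exp (-(8 * Real.pi ^ 2 * ‖FunctionSpaces.Torus.latticeVec ℓ‖ ^ 2 *
              (1 + (1 + δ) * ((1 - 4 * cubatureWord.ramp / 3) * c0) / ν ^ 2) * ν / (n:ℝ) ^ 2) * t)
            * ∫ x, ‖(UnitAddTorus.mFourier ℓ x).re • p‖ ^ 2 ≤ ∫ x, ‖w t x‖ ^ 2) :
    ∀ δ > (0:ℝ), ∃ M₀ > (0:ℝ), ∀ M : ℝ, ∀ hM : 0 < M, M₀ ≤ M → ∃ ν₀ > (0:ℝ), ∃ K > (0:ℝ),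
      ∀ ν, ∀ hν : ν ∈ Ioo 0 ν₀, ∀ n : ℕ, ∀ ℓ : Fin 3 → ℤ, ℓ ≠ 0 →
      ‖FunctionSpaces.Torus.latticeVec ℓ‖ * (⌈K / ν⌉₊ : ℝ) ≤ n → ∀ p : EuclideanSpace ℝ (Fin 3), ‖p‖ = 1 →
      ⟪p, FunctionSpaces.Torus.latticeVec ℓ⟫_ℝ = 0 → ∀ T > (0:ℝ), ∀ w,
      Torus.IsWeakPassiveVectorOn 0 T (ν / (n:ℝ) ^ 2)
          (((cubatureWord.stretch M hM).stretch (1 / ν) (one_div_pos.mpr hν.1)).cell n)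
          (fun x => (UnitAddTorus.mFourier ℓ x).re • p) w →
        ∀ᵐ t ∂(volume.restrict (Ioo 0 T)),
          (ν / K) * Real.exp (-(8 * Real.pi ^ 2 * ‖FunctionSpaces.Torus.latticeVec ℓ‖ ^ 2 *
              (1 + (1 + δ) * ((1 - 4 * cubatureWord.ramp / 3) * c0) / ν ^ 2) * ν / (n:ℝ) ^ 2) * t)
            * ∫ x, ‖(UnitAddTorus.mFourier ℓ x).re • p‖ ^ 2 ≤ ∫ x, ‖w t x‖ ^ 2 := by
  intro δ hδ
  obtain ⟨M₀, hM₀, H⟩ := hU δ hδ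
  refine ⟨M₀, hM₀, fun M hM hle => ?_⟩
  obtain ⟨ν₀, hν₀, K, hK, H1⟩ := H M hM hle
  refine ⟨ν₀, hν₀, K, hK, ?_⟩
  intro ν hν n ℓ hℓ hn p hp hpl T hT w hw
  obtain ⟨w', hw', hb⟩ := H1 ν hν n ℓ hℓ hn p hp hpl T hT
  have hκ : 0 < ν / (n:ℝ) ^ 2 := cellKappa_pos_of_mode hK hν.1 hℓ hn
  have hu := stub_cellUnique _ _ n _ T hκ _ w w' hw hw'
  filter_upwards [hb, hu] with t ht htu
  have e : ∫ x, ‖w t x‖ ^ 2 = ∫ x, ‖w' t x‖ ^ 2 :=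
    integral_congr_ae (htu.mono fun x hx => by simp only [hx])
  rw [e]
  exact ht

/-- **The UPPER-mode law is monotone in the regime** (any word `W'`, any constant `c`): shrinking `ν₀` and enlarging
`K` only weakens it — a larger `K` shrinks the admissible modes (`‖ℓ‖⌈K/ν⌉ ≤ n`) and the guaranteed fraction `ν/K`. -/
theorem upperModeLaw_mono {k : ℕ} (W' : LatticeWord k) (c ν₀ ν₀' K K' : ℝ) (hK : 0 < K) (hν : ν₀' ≤ ν₀)
    (hKK : K ≤ K')
    (h : ∀ ν, ∀ hν : ν ∈ Ioo 0 ν₀, ∀ n : ℕ, ∀ ℓ : Fin 3 → ℤ, ℓ ≠ 0 →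
      ‖FunctionSpaces.Torus.latticeVec ℓ‖ * (⌈K / ν⌉₊ : ℝ) ≤ n → ∀ p : EuclideanSpace ℝ (Fin 3), ‖p‖ = 1 →
      ⟪p, FunctionSpaces.Torus.latticeVec ℓ⟫_ℝ = 0 → ∀ T > (0:ℝ), ∀ w,
      Torus.IsWeakPassiveVectorOn 0 T (ν / (n:ℝ) ^ 2) ((W'.stretch (1 / ν) (one_div_pos.mpr hν.1)).cell n)
        (fun x => (UnitAddTorus.mFourier ℓ x).re • p) w →
      ∀ᵐ t ∂(volume.restrict (Ioo 0 T)),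
        (ν / K) * Real.exp (-(8 * Real.pi ^ 2 * ‖FunctionSpaces.Torus.latticeVec ℓ‖ ^ 2 * (1 + c / ν ^ 2) * ν
            / (n:ℝ) ^ 2) * t) * ∫ x, ‖(UnitAddTorus.mFourier ℓ x).re • p‖ ^ 2 ≤ ∫ x, ‖w t x‖ ^ 2) :
    ∀ ν, ∀ hν : ν ∈ Ioo 0 ν₀', ∀ n : ℕ, ∀ ℓ : Fin 3 → ℤ, ℓ ≠ 0 →
      ‖FunctionSpaces.Torus.latticeVec ℓ‖ * (⌈K' / ν⌉₊ : ℝ) ≤ n → ∀ p : EuclideanSpace ℝ (Fin 3), ‖p‖ = 1 →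
      ⟪p, FunctionSpaces.Torus.latticeVec ℓ⟫_ℝ = 0 → ∀ T > (0:ℝ), ∀ w,
      Torus.IsWeakPassiveVectorOn 0 T (ν / (n:ℝ) ^ 2) ((W'.stretch (1 / ν) (one_div_pos.mpr hν.1)).cell n)
        (fun x => (UnitAddTorus.mFourier ℓ x).re • p) w →
      ∀ᵐ t ∂(volume.restrict (Ioo 0 T)),
        (ν / K') * Real.exp (-(8 * Real.pi ^ 2 * ‖FunctionSpaces.Torus.latticeVec ℓ‖ ^ 2 * (1 + c / ν ^ 2) * ν
            / (n:ℝ) ^ 2) * t) * ∫ x, ‖(UnitAddTorus.mFourier ℓ x).re • p‖ ^ 2 ≤ ∫ x, ‖w t x‖ ^ 2 := by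
  intro ν hν' n ℓ hℓ hn p hp hpl T hT w hw
  have hνν : ν ∈ Set.Ioo 0 ν₀ := ⟨hν'.1, lt_of_lt_of_le hν'.2 hν⟩
  have hceil : (⌈K / ν⌉₊ : ℝ) ≤ (⌈K' / ν⌉₊ : ℝ) := by
    exact_mod_cast Nat.ceil_mono (div_le_div_of_nonneg_right hKK hν'.1.le)
  have hn' : ‖FunctionSpaces.Torus.latticeVec ℓ‖ * (⌈K / ν⌉₊ : ℝ) ≤ n :=
    le_trans (mul_le_mul_of_nonneg_left hceil (norm_nonneg _)) hn
  have h1 := h ν hνν n ℓ hℓ hn' p hp hpl T hT w hw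
  filter_upwards [h1] with t ht
  refine le_trans ?_ ht
  have hI : 0 ≤ ∫ x, ‖(UnitAddTorus.mFourier ℓ x).re • p‖ ^ 2 := integral_nonneg fun x => by positivity
  have hE : 0 ≤ Real.exp (-(8 * Real.pi ^ 2 * ‖FunctionSpaces.Torus.latticeVec ℓ‖ ^ 2 * (1 + c / ν ^ 2) * ν
      / (n:ℝ) ^ 2) * t) := (Real.exp_pos _).le
  have hfrac : ν / K' ≤ ν / K := div_le_div_of_nonneg_left hν'.1.le hK hKK
  exact mul_le_mul_of_nonneg_right (mul_le_mul_of_nonneg_right hfrac hE) hI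

end Summit.AnomalousDissipation.AnomalousDissipation.Theorems.SolenoidalFractalHomogenisation.RealisedQuasiStaticCellLaw

end
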